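import Summits.Ventures.LatticeQCDFlow.Scaling.HubClassStartContentDeficitEnum
import Summits.Ventures.LatticeQCDFlow.Scaling.HubClassGlobalDomination

/-!
HONEST FRAMING: exact (Metropolis-corrected) sampling algorithms for lattice gauge theory; figures
of merit are autocorrelation/cost numbers at stated couplings and volumes; no continuum-physics
claim.

# HubClassGlobalStartContentAbove — THE START-CONTENT DEFICIT FOR A HUB AT OR ABOVE THE UPPER POSITION OF THE MOVED CONTENT, RANK-FREE AND GLOBAL: NO DEFICIT WHEN A THIRD
# PARTICLE SITS AT OR ABOVE THE UPPER POSITION; IN EVERY CASE `e_{n+1} ≤ 𝟙{n even}K^{−(n+1)}/2` AND `e_1 ≤ 0` (lean-2 GEN-42, ours)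

Venture-side (OURS).  Cell `lqcd-flow` (pub-lqcd), unit `pub-lqcd-lean-2-g42`, 2026-08-30.  Chapter AB (route (β), the cost side continued), file 8 — the companion of file 4 for hubs
ABOVE the extra particles (configurations (C) ∕ (D) of GEN-41 file 5, made global).  Two persistence profiles `W^X, W^Y > 0` agreeing off `t`, `W^Y_t < W^X_t`, `N(t) = 1`,
`ΣN = K+1`, `K ≥ 2`, chapter W's hub kernels and powers; a present hub `z ≠ t` with `W^X_t ≤ W_z` (the tie `W_z = W^X_t` INCLUDED); NO condition on the contents between.

* `global_above_stepOne`: `e_1 = Kh_Y(N;z,z) − Kh_X(N;z,z) ≤ 0` (lowering `t` raises the hub's acceptance of it).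
* `global_above_base` (no present content strictly between): in the common enumeration sorted by `W^X + W^Y` the hub precedes `t`; EITHER three particles sit at ranks `≤ rank(t)`
  (GEN-41 file 5 (C): no deficit) OR `z` is alone at rank 0 and `t` at rank 1 (GEN-41 file 5 (D): `e_{n+1} ≤ 𝟙{n even}K^{−(n+1)}·r/(1+r)`, `r = W^Y_t/W_z ≤ 1`) — the dichotomy is
  exhaustive, so ties (a content exactly at `W^Y_t`, or `W_z = W^X_t`) need no separate treatment: (i) a present `w ∉ {z,t}` with `W^X_t ≤ W_w`, or `N(z) ≥ 2` ⇒ `e_n ≤ 0` for all `n`;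
  (ii) always `e_{n+1} ≤ 𝟙{n even}K^{−(n+1)}/2`; (iii) `e_1 ≤ 0`.
* **`hubClass_global_startClass_above`**: (i) ∧ (ii) ∧ (iii) for ANY two such profiles, by induction on the number of present contents strictly between `W^Y_t` and `W^X_t`: for the
  intermediate profile `Z` (`t` at the persistence `W_u` of a content `u` strictly between) the lower half-move `(Z,Y)` has the witness `u` itself (`W^Z_t = W_u ≤ W_u`), hence NO
  deficit, and the upper half-move `(X,Z)` keeps the hypotheses — the bound does not accumulate.

TOY (`numerics42/tieC.py`, exact rationals, NOTHING CLAIMED): in the tie «a content exactly at `W^Y_t`» there is in fact no deficit at all (0 ∕ 4 000); (ii) is what the dichotomy proves.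
File 9 moves this to W26's tagged chains and pays the budget with GEN-41 file 10's income.  Literature grade (cell rule): OWN; nothing cited; no new bib keys.
-/

open Finset

namespace Summit.Ventures.LatticeQCDFlow.Scaling

section GlobalAbove
variable {S : Type*} [Fintype S] [DecidableEq S]

/-! ### §1 The first step and the base -/

/-- **`e_1 ≤ 0`:** `Kh_Yⁿ(N;z,z) − Kh_Xⁿ(N;z,z) ≤ 0` at `n = 1` (the hub accepts the moved content at least as often in `Y`). [ours] -/
theorem global_above_stepOne {WX WY : S → ℝ} {accX accY : S → S → ℝ} {KhX KhY : (S → ℕ) → S → S → ℝ} {K : ℕ} {N : S → ℕ} {t z : S}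
    {KhnX KhnY : ℕ → S → S → ℝ}
    (hWX : ∀ v, 0 < WX v) (hWY : ∀ v, 0 < WY v) (hagree : ∀ v, v ≠ t → WX v = WY v) (hWt : WY t ≤ WX t) (hK : 1 ≤ K)
    (haccX : ∀ h v, accX h v = min 1 (WX h / WX v)) (haccY : ∀ h v, accY h v = min 1 (WY h / WY v))
    (hKXoff : ∀ N' h v, h ≠ v → KhX N' h v = if N' h = 0 then 0 else (N' v : ℝ) / K * accX h v)
    (hKXdiag : ∀ N' h, KhX N' h h = 1 - ∑ v ∈ univ.erase h, KhX N' h v)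
    (hKYoff : ∀ N' h v, h ≠ v → KhY N' h v = if N' h = 0 then 0 else (N' v : ℝ) / K * accY h v)
    (hKYdiag : ∀ N' h, KhY N' h h = 1 - ∑ v ∈ univ.erase h, KhY N' h v)
    (hKhnX0 : ∀ h v, KhnX 0 h v = if h = v then 1 else 0) (hKhnXs : ∀ n h v, KhnX (n + 1) h v = ∑ w, KhnX n h w * KhX N w v)
    (hKhnY0 : ∀ h v, KhnY 0 h v = if h = v then 1 else 0) (hKhnYs : ∀ n h v, KhnY (n + 1) h v = ∑ w, KhnY n h w * KhY N w v)
    (hz : N z ≠ 0) (hzt : z ≠ t) : KhnY 1 z z ≤ KhnX 1 z z := by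
  have hK0 : (0 : ℝ) < K := by exact_mod_cast hK
  have h1X : KhnX 1 z z = KhX N z z := by
    rw [hKhnXs, ← Finset.sum_erase_add univ _ (mem_univ z), hKhnX0, if_pos rfl, one_mul]
    rw [sum_eq_zero fun w hw => by rw [hKhnX0, if_neg (ne_of_mem_erase hw).symm, zero_mul], zero_add]
  have h1Y : KhnY 1 z z = KhY N z z := by
    rw [hKhnYs, ← Finset.sum_erase_add univ _ (mem_univ z), hKhnY0, if_pos rfl, one_mul]
    rw [sum_eq_zero fun w hw => by rw [hKhnY0, if_neg (ne_of_mem_erase hw).symm, zero_mul], zero_add]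
  rw [h1X, h1Y, hKXdiag, hKYdiag]
  -- every off-diagonal entry of `Y` from `z` is at least that of `X`
  have hle : ∀ v ∈ univ.erase z, KhX N z v ≤ KhY N z v := by
    intro v hv
    have hvz : z ≠ v := (ne_of_mem_erase hv).symm
    rw [hKXoff N z v hvz, hKYoff N z v hvz, if_neg hz, if_neg hz, haccX, haccY, ← hagree z hzt]
    apply mul_le_mul_of_nonneg_left _ (div_nonneg (Nat.cast_nonneg _) hK0.le)
    by_cases hvt : v = t
    · rw [hvt]; exact min_le_min le_rfl (div_le_div_of_nonneg_left (hWX z).le (hWY t) hWt)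
    · rw [hagree v hvt]
  linarith [sum_le_sum hle]

/-- **The base of the induction** (no present content strictly between the two persistences of `t`). [ours] -/
theorem global_above_base {WX WY : S → ℝ} {accX accY : S → S → ℝ} {KhX KhY : (S → ℕ) → S → S → ℝ} {K : ℕ} {N : S → ℕ} {t z : S}
    {KhnX KhnY : ℕ → S → S → ℝ}
    (hWX : ∀ v, 0 < WX v) (hWY : ∀ v, 0 < WY v) (hagree : ∀ v, v ≠ t → WX v = WY v) (hWt : WY t < WX t)
    (haccX : ∀ h v, accX h v = min 1 (WX h / WX v)) (haccY : ∀ h v, accY h v = min 1 (WY h / WY v)) (hK : 2 ≤ K)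
    (hNK : ∑ v, (N v : ℝ) = K + 1) (hNt : N t = 1)
    (hKXoff : ∀ N' h v, h ≠ v → KhX N' h v = if N' h = 0 then 0 else (N' v : ℝ) / K * accX h v)
    (hKXdiag : ∀ N' h, KhX N' h h = 1 - ∑ v ∈ univ.erase h, KhX N' h v)
    (hKYoff : ∀ N' h v, h ≠ v → KhY N' h v = if N' h = 0 then 0 else (N' v : ℝ) / K * accY h v)
    (hKYdiag : ∀ N' h, KhY N' h h = 1 - ∑ v ∈ univ.erase h, KhY N' h v)
    (hKhnX0 : ∀ h v, KhnX 0 h v = if h = v then 1 else 0) (hKhnXs : ∀ n h v, KhnX (n + 1) h v = ∑ w, KhnX n h w * KhX N w v)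
    (hKhnY0 : ∀ h v, KhnY 0 h v = if h = v then 1 else 0) (hKhnYs : ∀ n h v, KhnY (n + 1) h v = ∑ w, KhnY n h w * KhY N w v)
    (hnone : ∀ v, N v ≠ 0 → v ≠ t → ¬ (WY t < WX v ∧ WX v < WX t))
    (hz : N z ≠ 0) (hzt : z ≠ t) (hza : WX t ≤ WX z) :
    ((2 ≤ N z ∨ ∃ w, w ≠ z ∧ w ≠ t ∧ N w ≠ 0 ∧ WX t ≤ WX w) → ∀ n, KhnY n z z ≤ KhnX n z z)
      ∧ (∀ n, KhnY (n + 1) z z - KhnX (n + 1) z z ≤ if Even n then (1 / (K : ℝ)) ^ (n + 1) / 2 else 0)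
      ∧ KhnY 1 z z ≤ KhnX 1 z z := by
  have hK1 : 1 ≤ K := by omega
  have hK0 : (0 : ℝ) < K := by exact_mod_cast hK1
  have hNt0 : N t ≠ 0 := by rw [hNt]; exact one_ne_zero
  obtain ⟨m, e, he_inj, he_pres, he_cov, hkey⟩ := global_exists_sorted_enum N (fun v => WX v + WY v) t
  obtain ⟨hsortX, hsortY⟩ := global_sorted_of_key hagree hWt.le hnone he_inj he_pres hkey
  obtain ⟨i, hi, hiz⟩ := he_cov z hz
  obtain ⟨s, hs, hst⟩ := he_cov t hNt0
  have hWz : WY z = WX z := (hagree z hzt).symm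
  -- the hub precedes `t`: `key(z) = 2W_z ≥ 2W^X_t > W^X_t + W^Y_t = key(t)`
  have his : i < s := by
    by_contra h
    have h' : s ≤ i := not_lt.mp h
    have := hkey s i h' hi
    rw [hiz, hst, hWz] at this
    linarith
  have hisne : i ≠ s := ne_of_lt his
  obtain ⟨-, -, hC, hD⟩ := hubClass_startClass_deficit_of_enum hWX hWY hagree hWt.le haccX haccY hK hNK hNt hKXoff hKXdiag hKYoff hKYdiag hKhnX0 hKhnXs hKhnY0 hKhnYs
    he_inj he_pres he_cov hsortX hsortY hi hs hiz hst hisne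
  -- a witness at or above `W^X_t` is ranked before `t`
  have hsub2 : ({i, s} : Finset ℕ) ⊆ range (s + 1) := by
    intro l hl
    rcases mem_insert.mp hl with h | h
    · rw [h]; exact mem_range.mpr (by omega)
    · rw [mem_singleton.mp h]; exact mem_range.mpr (by omega)
  have h3_of : (2 ≤ N z ∨ ∃ w, w ≠ z ∧ w ≠ t ∧ N w ≠ 0 ∧ WX t ≤ WX w) → (3 : ℝ) ≤ ∑ l ∈ range (s + 1), (N (e l) : ℝ) := by
    intro hw
    rcases hw with h2 | ⟨w, hwz, hwt, hw, hle⟩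
    · have hle := sum_le_sum_of_subset_of_nonneg hsub2 (f := fun l => (N (e l) : ℝ)) (fun l _ _ => Nat.cast_nonneg _)
      rw [sum_pair hisne, hst, hiz, hNt] at hle
      have : (2 : ℝ) ≤ N z := by exact_mod_cast h2
      push_cast at hle
      linarith
    · obtain ⟨j, hj, hjw⟩ := he_cov w hw
      have hjs : j < s := by
        by_contra h
        have h' : s ≤ j := not_lt.mp h
        have := hkey s j h' hj
        rw [hst, hjw, ← hagree w hwt] at this
        linarith
      have hji : j ≠ i := fun h => hwz (by rw [← hjw, h, hiz])
      have hjs' : j ≠ s := ne_of_lt hjs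
      have hsub3 : ({j, i, s} : Finset ℕ) ⊆ range (s + 1) := by
        intro l hl
        rcases mem_insert.mp hl with h | h
        · rw [h]; exact mem_range.mpr (by omega)
        · exact hsub2 h
      have hle' := sum_le_sum_of_subset_of_nonneg hsub3 (f := fun l => (N (e l) : ℝ)) (fun l _ _ => Nat.cast_nonneg _)
      have hjmem : j ∉ ({i, s} : Finset ℕ) := by
        intro h; rcases mem_insert.mp h with h | h
        · exact hji h
        · exact hjs' (mem_singleton.mp h)
      rw [sum_insert hjmem, sum_pair hisne, hst, hiz, hjw, hNt] at hle'
      have h1z : (1 : ℝ) ≤ N z := by exact_mod_cast Nat.one_le_iff_ne_zero.mpr hz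
      have h1w : (1 : ℝ) ≤ N w := by exact_mod_cast Nat.one_le_iff_ne_zero.mpr hw
      push_cast at hle'
      linarith
  have hone := global_above_stepOne hWX hWY hagree hWt.le hK1 haccX haccY hKXoff hKXdiag hKYoff hKYdiag hKhnX0 hKhnXs hKhnY0 hKhnYs hz hzt (N := N)
  refine ⟨fun hw => hC his (h3_of hw), fun n => ?_, hone⟩
  by_cases h3 : (3 : ℝ) ≤ ∑ l ∈ range (s + 1), (N (e l) : ℝ)
  · -- (C): no deficit
    have h := hC his h3 (n + 1)
    have hnn : (0 : ℝ) ≤ if Even n then (1 / (K : ℝ)) ^ (n + 1) / 2 else 0 := by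
      split_ifs
      · positivity
      · exact le_rfl
    linarith
  · -- (D): `z` alone at rank 0, `t` at rank 1 (every rank `≤ s` carries a particle)
    have hcount : ((s : ℝ) + 1) ≤ ∑ l ∈ range (s + 1), (N (e l) : ℝ) := by
      have h1 : ∀ l ∈ range (s + 1), (1 : ℝ) ≤ (N (e l) : ℝ) := fun l hl => by
        exact_mod_cast Nat.one_le_iff_ne_zero.mpr (he_pres l (by have := mem_range.mp hl; omega))
      have := sum_le_sum h1
      simp only [sum_const, card_range, nsmul_eq_mul, mul_one] at this
      push_cast at this
      linarith
    have hs1 : s = 1 := by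
      have : (s : ℝ) < 2 := by linarith
      have : s < 2 := by exact_mod_cast this
      omega
    have hi0 : i = 0 := by omega
    have hNz : N z = 1 := by
      have hle := sum_le_sum_of_subset_of_nonneg hsub2 (f := fun l => (N (e l) : ℝ)) (fun l _ _ => Nat.cast_nonneg _)
      rw [sum_pair hisne, hst, hiz, hNt] at hle
      push_cast at hle
      have : (N z : ℝ) < 2 := by linarith
      have : N z < 2 := by exact_mod_cast this
      omega
    obtain ⟨hD1, -⟩ := hD hi0 hs1 hNz
    have h := hD1 n
    -- `r/(1+r) ≤ 1/2` for `r = W^Y_t/W_z ≤ 1`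
    have hr0 : 0 < WY t / WX z := div_pos (hWY t) (hWX z)
    have hr1 : WY t / WX z ≤ 1 := by rw [div_le_one (hWX z)]; linarith
    have hfrac : WY t / WX z / (1 + WY t / WX z) ≤ 1 / 2 := by
      rw [div_le_iff₀ (by linarith)]; linarith
    refine h.trans ?_
    split_ifs with hev
    · have hp : 0 ≤ (1 / (K : ℝ)) ^ (n + 1) := by positivity
      calc (1 / (K : ℝ)) ^ (n + 1) * (WY t / WX z / (1 + WY t / WX z)) ≤ (1 / (K : ℝ)) ^ (n + 1) * (1 / 2) :=
            mul_le_mul_of_nonneg_left hfrac hp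
        _ = (1 / (K : ℝ)) ^ (n + 1) / 2 := by ring
    · exact le_rfl

/-! ### §2 The global theorem: induction on the number of contents crossed -/

/-- **THE START-CONTENT DEFICIT FOR A HUB AT OR ABOVE THE MOVED CONTENT, RANK-FREE AND GLOBAL** (see the module docstring). [ours] -/
theorem hubClass_global_startClass_above {K : ℕ} {N : S → ℕ} {t z : S} (hK : 2 ≤ K) (hNK : ∑ v, (N v : ℝ) = K + 1) (hNt : N t = 1)
    {WX WY : S → ℝ} {accX accY : S → S → ℝ} {KhX KhY : (S → ℕ) → S → S → ℝ} {KhnX KhnY : ℕ → S → S → ℝ}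
    (hWX : ∀ v, 0 < WX v) (hWY : ∀ v, 0 < WY v) (hagree : ∀ v, v ≠ t → WX v = WY v) (hWt : WY t < WX t)
    (haccX : ∀ h v, accX h v = min 1 (WX h / WX v)) (haccY : ∀ h v, accY h v = min 1 (WY h / WY v))
    (hKXoff : ∀ N' h v, h ≠ v → KhX N' h v = if N' h = 0 then 0 else (N' v : ℝ) / K * accX h v)
    (hKXdiag : ∀ N' h, KhX N' h h = 1 - ∑ v ∈ univ.erase h, KhX N' h v)
    (hKYoff : ∀ N' h v, h ≠ v → KhY N' h v = if N' h = 0 then 0 else (N' v : ℝ) / K * accY h v)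
    (hKYdiag : ∀ N' h, KhY N' h h = 1 - ∑ v ∈ univ.erase h, KhY N' h v)
    (hKhnX0 : ∀ h v, KhnX 0 h v = if h = v then 1 else 0) (hKhnXs : ∀ n h v, KhnX (n + 1) h v = ∑ w, KhnX n h w * KhX N w v)
    (hKhnY0 : ∀ h v, KhnY 0 h v = if h = v then 1 else 0) (hKhnYs : ∀ n h v, KhnY (n + 1) h v = ∑ w, KhnY n h w * KhY N w v)
    (hz : N z ≠ 0) (hzt : z ≠ t) (hza : WX t ≤ WX z) :
    ((2 ≤ N z ∨ ∃ w, w ≠ z ∧ w ≠ t ∧ N w ≠ 0 ∧ WX t ≤ WX w) → ∀ n, KhnY n z z ≤ KhnX n z z)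
      ∧ (∀ n, KhnY (n + 1) z z - KhnX (n + 1) z z ≤ if Even n then (1 / (K : ℝ)) ^ (n + 1) / 2 else 0)
      ∧ KhnY 1 z z ≤ KhnX 1 z z := by
  classical
  suffices key : ∀ (B : ℕ) (WX WY : S → ℝ) (accX accY : S → S → ℝ) (KhX KhY : (S → ℕ) → S → S → ℝ) (KhnX KhnY : ℕ → S → S → ℝ),
      (univ.filter fun v => N v ≠ 0 ∧ WY t < WX v ∧ WX v < WX t).card ≤ B →
      (∀ v, 0 < WX v) → (∀ v, 0 < WY v) → (∀ v, v ≠ t → WX v = WY v) → WY t < WX t →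
      (∀ h v, accX h v = min 1 (WX h / WX v)) → (∀ h v, accY h v = min 1 (WY h / WY v)) →
      (∀ N' h v, h ≠ v → KhX N' h v = if N' h = 0 then 0 else (N' v : ℝ) / K * accX h v) →
      (∀ N' h, KhX N' h h = 1 - ∑ v ∈ univ.erase h, KhX N' h v) →
      (∀ N' h v, h ≠ v → KhY N' h v = if N' h = 0 then 0 else (N' v : ℝ) / K * accY h v) →
      (∀ N' h, KhY N' h h = 1 - ∑ v ∈ univ.erase h, KhY N' h v) →
      (∀ h v, KhnX 0 h v = if h = v then 1 else 0) → (∀ n h v, KhnX (n + 1) h v = ∑ w, KhnX n h w * KhX N w v) →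
      (∀ h v, KhnY 0 h v = if h = v then 1 else 0) → (∀ n h v, KhnY (n + 1) h v = ∑ w, KhnY n h w * KhY N w v) →
      WX t ≤ WX z →
      ((2 ≤ N z ∨ ∃ w, w ≠ z ∧ w ≠ t ∧ N w ≠ 0 ∧ WX t ≤ WX w) → ∀ n, KhnY n z z ≤ KhnX n z z)
        ∧ (∀ n, KhnY (n + 1) z z - KhnX (n + 1) z z ≤ if Even n then (1 / (K : ℝ)) ^ (n + 1) / 2 else 0)
        ∧ KhnY 1 z z ≤ KhnX 1 z z from
    key _ WX WY accX accY KhX KhY KhnX KhnY le_rfl hWX hWY hagree hWt haccX haccY hKXoff hKXdiag hKYoff hKYdiag hKhnX0 hKhnXs hKhnY0 hKhnYs hza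
  intro B
  induction B with
  | zero =>
      intro WX WY accX accY KhX KhY KhnX KhnY hB hWX hWY hagree hWt haccX haccY hKXoff hKXdiag hKYoff hKYdiag hKhnX0 hKhnXs hKhnY0 hKhnYs hza
      have hnone : ∀ v, N v ≠ 0 → v ≠ t → ¬ (WY t < WX v ∧ WX v < WX t) := by
        intro v hv _ hb
        have : v ∈ univ.filter fun v => N v ≠ 0 ∧ WY t < WX v ∧ WX v < WX t := mem_filter.mpr ⟨mem_univ v, hv, hb⟩
        rw [Finset.card_eq_zero.mp (Nat.le_zero.mp hB)] at this
        exact absurd this (Finset.notMem_empty v)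
      exact global_above_base hWX hWY hagree hWt haccX haccY hK hNK hNt hKXoff hKXdiag hKYoff hKYdiag hKhnX0 hKhnXs hKhnY0 hKhnYs hnone hz hzt hza
  | succ B ih =>
      intro WX WY accX accY KhX KhY KhnX KhnY hB hWX hWY hagree hWt haccX haccY hKXoff hKXdiag hKYoff hKYdiag hKhnX0 hKhnXs hKhnY0 hKhnYs hza
      by_cases hempty : (univ.filter fun v => N v ≠ 0 ∧ WY t < WX v ∧ WX v < WX t) = ∅
      · have hnone : ∀ v, N v ≠ 0 → v ≠ t → ¬ (WY t < WX v ∧ WX v < WX t) := by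
          intro v hv _ hb
          have : v ∈ univ.filter fun v => N v ≠ 0 ∧ WY t < WX v ∧ WX v < WX t := mem_filter.mpr ⟨mem_univ v, hv, hb⟩
          rw [hempty] at this
          exact absurd this (Finset.notMem_empty v)
        exact global_above_base hWX hWY hagree hWt haccX haccY hK hNK hNt hKXoff hKXdiag hKYoff hKYdiag hKhnX0 hKhnXs hKhnY0 hKhnYs hnone hz hzt hza
      obtain ⟨u, hu⟩ := Finset.nonempty_iff_ne_empty.mpr hempty
      have hu' := (mem_filter.mp hu).2
      have hut : u ≠ t := fun h => by rw [h] at hu'; exact lt_irrefl _ hu'.2.2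
      have huz : u ≠ z := fun h => by rw [h] at hu'; linarith [hu'.2.2]
      -- a content `u` strictly between: the intermediate profile `W^Z` (`t` moved to `W_u`), its kernel and powers; then two shorter moves (verbatim from Z3)
      obtain ⟨WZ, hWZ⟩ : ∃ WZ : S → ℝ, ∀ v, WZ v = if v = t then WX u else WX v := ⟨_, fun _ => rfl⟩
      obtain ⟨accZ, haccZ⟩ : ∃ accZ : S → S → ℝ, ∀ h v, accZ h v = min 1 (WZ h / WZ v) := ⟨_, fun _ _ => rfl⟩
      obtain ⟨offZ, hoffZ⟩ : ∃ offZ : (S → ℕ) → S → S → ℝ, ∀ N' h v, offZ N' h v = if N' h = 0 then 0 else (N' v : ℝ) / K * accZ h v := ⟨_, fun _ _ _ => rfl⟩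
      obtain ⟨KhZ, hKhZ⟩ : ∃ KhZ : (S → ℕ) → S → S → ℝ, ∀ N' h v, KhZ N' h v = if h = v then 1 - ∑ v' ∈ univ.erase h, offZ N' h v' else offZ N' h v :=
        ⟨_, fun _ _ _ => rfl⟩
      let KhnZ : ℕ → S → S → ℝ := fun n => Nat.rec (motive := fun _ => S → S → ℝ) (fun h v => if h = v then 1 else 0) (fun _ prev h v => ∑ w', prev h w' * KhZ N w' v) n
      have hKhnZ0 : ∀ h v, KhnZ 0 h v = if h = v then 1 else 0 := fun _ _ => rfl
      have hKhnZs : ∀ n h v, KhnZ (n + 1) h v = ∑ w', KhnZ n h w' * KhZ N w' v := fun _ _ _ => rfl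
      have hWZpos : ∀ v, 0 < WZ v := fun v => by rw [hWZ]; split_ifs <;> exact hWX _
      have hKZoff : ∀ N' h v, h ≠ v → KhZ N' h v = if N' h = 0 then 0 else (N' v : ℝ) / K * accZ h v := fun N' h v hhv => by
        rw [hKhZ, if_neg hhv, hoffZ]
      have hKZdiag : ∀ N' h, KhZ N' h h = 1 - ∑ v ∈ univ.erase h, KhZ N' h v := fun N' h => by
        rw [hKhZ, if_pos rfl]
        congr 1
        exact sum_congr rfl fun v hv => by rw [hKhZ, if_neg (ne_of_mem_erase hv).symm]
      have hagreeXZ : ∀ v, v ≠ t → WX v = WZ v := fun v hv => by rw [hWZ, if_neg hv]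
      have hagreeZY : ∀ v, v ≠ t → WZ v = WY v := fun v hv => by rw [hWZ, if_neg hv, hagree v hv]
      have hZt : WZ t = WX u := by rw [hWZ, if_pos rfl]
      have hZz : WZ z = WX z := by rw [hWZ, if_neg hzt]
      -- the two half-moves cross fewer contents (verbatim from Z3)
      have hBXZ : (univ.filter fun v => N v ≠ 0 ∧ WZ t < WX v ∧ WX v < WX t).card ≤ B := by
        have hsub : (univ.filter fun v => N v ≠ 0 ∧ WZ t < WX v ∧ WX v < WX t) ⊆ (univ.filter fun v => N v ≠ 0 ∧ WY t < WX v ∧ WX v < WX t).erase u := by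
          intro v hv
          have hv' := (mem_filter.mp hv).2
          rw [hZt] at hv'
          refine mem_erase.mpr ⟨fun h => ?_, mem_filter.mpr ⟨mem_univ v, hv'.1, by linarith [hu'.2.1], hv'.2.2⟩⟩
          rw [h] at hv'; exact lt_irrefl _ hv'.2.1
        have := card_le_card hsub
        rw [card_erase_of_mem hu] at this
        omega
      have hBZY : (univ.filter fun v => N v ≠ 0 ∧ WY t < WZ v ∧ WZ v < WZ t).card ≤ B := by
        have hsub : (univ.filter fun v => N v ≠ 0 ∧ WY t < WZ v ∧ WZ v < WZ t) ⊆ (univ.filter fun v => N v ≠ 0 ∧ WY t < WX v ∧ WX v < WX t).erase u := by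
          intro v hv
          have hv' := (mem_filter.mp hv).2
          have hvt : v ≠ t := fun h => by rw [h] at hv'; exact lt_irrefl _ hv'.2.2
          rw [hZt, ← hagreeXZ v hvt] at hv'
          refine mem_erase.mpr ⟨fun h => ?_, mem_filter.mpr ⟨mem_univ v, hv'.1, hv'.2.1, by linarith [hu'.2.2]⟩⟩
          rw [h] at hv'; exact lt_irrefl _ hv'.2.2
        have := card_le_card hsub
        rw [card_erase_of_mem hu] at this
        omega
      -- the hypotheses at the hub for the two half-moves
      have hzaXZ : WX t ≤ WX z := hza
      have hzaZY : WZ t ≤ WZ z := by rw [hZt, hZz]; linarith [hu'.2.2]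
      have hWtXZ : WZ t < WX t := by rw [hZt]; exact hu'.2.2
      have hWtZY : WY t < WZ t := by rw [hZt]; exact hu'.2.1
      -- the two half-moves
      have h1 := ih WX WZ accX accZ KhX KhZ KhnX KhnZ hBXZ hWX hWZpos hagreeXZ hWtXZ haccX haccZ hKXoff hKXdiag hKZoff hKZdiag
        hKhnX0 hKhnXs hKhnZ0 hKhnZs hzaXZ
      have h2 := ih WZ WY accZ accY KhZ KhY KhnZ KhnY hBZY hWZpos hWY hagreeZY hWtZY haccZ haccY hKZoff hKZdiag hKYoff hKYdiag
        hKhnZ0 hKhnZs hKhnY0 hKhnYs hzaZY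
      obtain ⟨hC1, hB1, hO1⟩ := h1
      obtain ⟨hC2, -, -⟩ := h2
      -- the lower half-move has the witness `u` itself: no deficit there
      have hno2 : ∀ n, KhnY n z z ≤ KhnZ n z z := hC2 (Or.inr ⟨u, huz, hut, hu'.1, by rw [hZt, ← hagreeXZ u hut]⟩)
      refine ⟨fun hw n => ?_, fun n => ?_, ?_⟩
      · have hwXZ : 2 ≤ N z ∨ ∃ w, w ≠ z ∧ w ≠ t ∧ N w ≠ 0 ∧ WX t ≤ WX w := hw
        linarith [hC1 hwXZ n, hno2 n]
      · linarith [hB1 n, hno2 (n + 1)]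
      · linarith [hO1, hno2 1]

end GlobalAbove

end Summit.Ventures.LatticeQCDFlow.Scaling
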